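import Summits.CriticalPhenomena.PercolationContinuityZ3.Theorems.PercNearOneGluingNoHeavyLowerTailSunflowerPendantAnalytic
import HarnessLib

/-!
# `NoHeavyLowerTail` (crux stmt-CriticalPhenomena-4575), abstract sunflower cubic: PENDANT INVARIANCE — the product bound

Support file (seat `prim-ineq-prove-1` gen 49; `--supports stmt-CriticalPhenomena-4575`).  No `sorry`, no named facts.
Memo: run/shared/lean/prim/prim-ineq-prove-1/FINDING-PENDANT-prove1-g49.md §2.

THE PENDANT BOUND (`pendant_prod_le`).  Let `0 < b ≤ β`, `s, t ∈ [0,1]`, `a₀ = (1−s)b + sβ`, and for `j < n` let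
`u_j ≥ b`, `vv_j ≥ β`, `b ≤ m_j ≤ u_j` with
  `∏ u_j ≤ b^(n−1)`,   `∏ vv_j ≤ β^(n−1)`,   `∏ ((1−s)m_j + s·vv_j) ≤ a₀^(n−1)`.
Then `∏_j (st + s(1−t)vv_j + (1−s)t·u_j + (1−s)(1−t)m_j) ≤ (st + s(1−t)β + (1−s)b)^(n−1)`.
(These are the data of a petal system of `A ∪ {v, z open}` conditioned on the block `{v, z}`, `z` a pendant coordinate
attached to `v`: `u`/`vv`/`m` = measures of the sections at `(v,z) = (0,1), (1,0), (0,0)`; the three product hypotheses are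
safety of `A|_{v=0}`, of `A|_{v=1}` and of `A`; see `…SunflowerPendant`.  The bounds `u_j, vv_j ≤ 1` and `m_j ≤ vv_j`, true
there, are not needed.)
PROOF.  Normalise `x_j = u_j/b`, `y_j = g_j/a₀` (`g_j = (1−s)m_j + s·vv_j`), `z_j = vv_j/β`, all `≥ 1`, `b∏x ≤ 1`, `a₀∏y ≤ 1`,
`β∏z ≤ 1`; each factor is `ψ(x_j, y_j)` (`…PendantAnalytic.pfun` with `σ = st`, `τ = t(1−s)b`, `ρ = (1−t)a₀`; `ψ(1,1) =` the
target base, `ψ(1/b, 1/a₀) = 1`).  Merge the "u-heavy" petals (`y_j ≤ x_j`) into one petal `(X_P, Y_P)` and the "g-heavy" ones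
(`x_j < y_j`; they satisfy `x_j ≤ z_j` and the link `a₀y_j ≤ lfun(x_j, z_j)`) into `(X_Q, Y_Q)` with `a₀Y_Q ≤ (1−s)bX_Q + s`
(`prod_pfun_le_merged`, `prod_lfun_le`; `normalised_bound`); if one class is empty, monotonicity of `ψ` finishes; otherwise
`ψ(X_P,Y_P) ≤ ψ(1/(bX_Q), 1/(a₀Y_Q))` and `final_two` gives the last factor `ψ(1,1)` (`mixed_step`).
The degenerate case `b = 0` is `…PendantAnalytic.pendant_prod_le_zero` (there the `u_j` are pairwise orthogonal by Harris).
-/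

noncomputable section

namespace Summit.CriticalPhenomena.PercolationContinuityZ3.Theorems.SunflowerPartition

namespace SafeCalc

open Finset

namespace Pendant

/-- Products of reals `≥ 1` over a finset are `≥ 1`. [this work] -/
theorem one_le_prod_of_one_le {κ : Type*} {f : κ → ℝ} (S : Finset κ) (h : ∀ j ∈ S, 1 ≤ f j) : 1 ≤ ∏ j ∈ S, f j := by
  have := Finset.prod_le_prod (s := S) (fun j _ => zero_le_one) h; simpa using this

/-- **The mixed step**: a merged u-heavy petal `(XP, YP)` and a merged g-heavy petal `(XQ, YQ)` (with the link
`a₀·YQ ≤ (1−s)b·XQ + s`) sharing the budgets `b·XP·XQ ≤ 1`, `a₀·YP·YQ ≤ 1` contribute at most one more factor `ψ(1,1)`.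
[this work] -/
theorem mixed_step {b β s t XP YP XQ YQ AP AQ : ℝ} {kP kQ : ℕ} (hb : 0 < b) (hbβ : b ≤ β) (hs : 0 ≤ s) (hs1 : s ≤ 1)
    (ht : 0 ≤ t) (ht1 : t ≤ 1) (hXP : 1 ≤ XP) (hYP : 1 ≤ YP) (hXQ : 1 ≤ XQ) (hYQ : 1 ≤ YQ) (hXYQ : XQ ≤ YQ)
    (hbX : b * (XP * XQ) ≤ 1) (haY : ((1 - s) * b + s * β) * (YP * YQ) ≤ 1)
    (hlink : ((1 - s) * b + s * β) * YQ ≤ (1 - s) * b * XQ + s) (hAP0 : 0 ≤ AP)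
    (hAP : AP ≤ pfun (s * t) (t * (1 - s) * b) ((1 - t) * ((1 - s) * b + s * β)) 1 1 ^ kP *
      pfun (s * t) (t * (1 - s) * b) ((1 - t) * ((1 - s) * b + s * β)) XP YP)
    (hAQ : AQ ≤ pfun (s * t) (t * (1 - s) * b) ((1 - t) * ((1 - s) * b + s * β)) 1 1 ^ kQ *
      pfun (s * t) (t * (1 - s) * b) ((1 - t) * ((1 - s) * b + s * β)) XQ YQ) :
    AP * AQ ≤ pfun (s * t) (t * (1 - s) * b) ((1 - t) * ((1 - s) * b + s * β)) 1 1 ^ (kP + kQ + 1) := by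
  set a₀ : ℝ := (1 - s) * b + s * β with ha₀
  set σ : ℝ := s * t with hσ
  set τ : ℝ := t * (1 - s) * b with hτ
  set ρ : ℝ := (1 - t) * a₀ with hρ
  have hs' : 0 ≤ 1 - s := sub_nonneg.2 hs1
  have ht' : 0 ≤ 1 - t := sub_nonneg.2 ht1
  have ha₀b : b ≤ a₀ := by
    have := mul_le_mul_of_nonneg_left hbβ hs
    rw [ha₀]; linarith
  have ha₀pos : 0 < a₀ := hb.trans_le ha₀b
  have hσ0 : 0 ≤ σ := mul_nonneg hs ht
  have hτ0 : 0 ≤ τ := mul_nonneg (mul_nonneg ht hs') hb.le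
  have hρ0 : 0 ≤ ρ := mul_nonneg ht' ha₀pos.le
  have hcnn : 0 ≤ pfun σ τ ρ 1 1 := pfun_nonneg hσ0 hτ0 hρ0 zero_le_one zero_le_one
  have hXQpos : 0 < XQ := zero_lt_one.trans_le hXQ
  have hYQpos : 0 < YQ := zero_lt_one.trans_le hYQ
  have hbXQ : b * XQ ≤ 1 :=
    calc b * XQ = (b * XQ) * 1 := (mul_one _).symm
      _ ≤ (b * XQ) * XP := mul_le_mul_of_nonneg_left hXP (mul_nonneg hb.le hXQpos.le)
      _ = b * (XP * XQ) := by ring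
      _ ≤ 1 := hbX
  have hXPle : XP ≤ 1 / (b * XQ) := by
    rw [le_div_iff₀ (mul_pos hb hXQpos)]
    calc XP * (b * XQ) = b * (XP * XQ) := by ring
      _ ≤ 1 := hbX
  have hYPle : YP ≤ 1 / (a₀ * YQ) := by
    rw [le_div_iff₀ (mul_pos ha₀pos hYQpos)]
    calc YP * (a₀ * YQ) = a₀ * (YP * YQ) := by ring
      _ ≤ 1 := haY
  have hfin := final_two (β := β) hb hbβ hs hs1 ht ht1 hXQ hXYQ hbXQ hlink
  simp only [← ha₀] at hfin
  rw [← hσ, ← hτ, ← hρ] at hfin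
  have hmono : pfun σ τ ρ XP YP ≤ pfun σ τ ρ (1 / (b * XQ)) (1 / (a₀ * YQ)) := pfun_mono hτ0 hρ0 hXPle hYPle
  have hQnn : 0 ≤ pfun σ τ ρ XQ YQ := pfun_nonneg hσ0 hτ0 hρ0 hXQpos.le hYQpos.le
  have hBnn : 0 ≤ pfun σ τ ρ 1 1 ^ kP * pfun σ τ ρ XP YP :=
    mul_nonneg (pow_nonneg hcnn _) (pfun_nonneg hσ0 hτ0 hρ0 (zero_le_one.trans hXP) (zero_le_one.trans hYP))
  have hAQ0 : 0 ≤ AQ ∨ AQ < 0 := le_or_gt 0 AQ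
  rcases hAQ0 with hAQ0 | hAQneg
  · calc AP * AQ ≤ (pfun σ τ ρ 1 1 ^ kP * pfun σ τ ρ XP YP) * (pfun σ τ ρ 1 1 ^ kQ * pfun σ τ ρ XQ YQ) :=
          mul_le_mul hAP hAQ hAQ0 hBnn
      _ = pfun σ τ ρ 1 1 ^ (kP + kQ) * (pfun σ τ ρ XP YP * pfun σ τ ρ XQ YQ) := by rw [pow_add]; ring
      _ ≤ pfun σ τ ρ 1 1 ^ (kP + kQ) * (pfun σ τ ρ (1 / (b * XQ)) (1 / (a₀ * YQ)) * pfun σ τ ρ XQ YQ) :=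
          mul_le_mul_of_nonneg_left (mul_le_mul_of_nonneg_right hmono hQnn) (pow_nonneg hcnn _)
      _ ≤ pfun σ τ ρ 1 1 ^ (kP + kQ) * pfun σ τ ρ 1 1 := mul_le_mul_of_nonneg_left hfin (pow_nonneg hcnn _)
      _ = pfun σ τ ρ 1 1 ^ (kP + kQ + 1) := (pow_succ _ _).symm
  · -- `AQ < 0`: the left side is `≤ 0`
    have h1 : AP * AQ ≤ 0 := mul_nonpos_of_nonneg_of_nonpos hAP0 hAQneg.le
    exact h1.trans (pow_nonneg hcnn _)

/-- **The normalised bound**: for `x_j, y_j, z_j ≥ 1` with `b∏x ≤ 1`, `a₀∏y ≤ 1`, `β∏z ≤ 1` and the link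
`x_j ≤ z_j ∧ a₀y_j ≤ lfun(x_j, z_j)` for every g-heavy `j` (`x_j < y_j`): `∏ ψ(x_j, y_j) ≤ ψ(1,1)^(n−1)`. [this work] -/
theorem normalised_bound {n : ℕ} {b β s t : ℝ} (hb : 0 < b) (hbβ : b ≤ β) (hs : 0 ≤ s) (hs1 : s ≤ 1) (ht : 0 ≤ t)
    (ht1 : t ≤ 1) (x y z : Fin n → ℝ) (hx1 : ∀ j, 1 ≤ x j) (hy1 : ∀ j, 1 ≤ y j) (hz1 : ∀ j, 1 ≤ z j)
    (hPx : b * ∏ j, x j ≤ 1) (hPy : ((1 - s) * b + s * β) * ∏ j, y j ≤ 1) (hPz : β * ∏ j, z j ≤ 1)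
    (hxz : ∀ j, x j < y j → x j ≤ z j)
    (hlink : ∀ j, x j < y j → ((1 - s) * b + s * β) * y j ≤ lfun b β s (x j) (z j)) :
    ∏ j, pfun (s * t) (t * (1 - s) * b) ((1 - t) * ((1 - s) * b + s * β)) (x j) (y j) ≤
      pfun (s * t) (t * (1 - s) * b) ((1 - t) * ((1 - s) * b + s * β)) 1 1 ^ (n - 1) := by
  classical
  rcases Nat.eq_zero_or_pos n with hn | hn
  · subst hn; simp
  set a₀ : ℝ := (1 - s) * b + s * β with ha₀
  set σ : ℝ := s * t with hσ
  set τ : ℝ := t * (1 - s) * b with hτ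
  set ρ : ℝ := (1 - t) * a₀ with hρ
  have hs' : 0 ≤ 1 - s := sub_nonneg.2 hs1
  have ht' : 0 ≤ 1 - t := sub_nonneg.2 ht1
  have hβpos : 0 < β := hb.trans_le hbβ
  have ha₀b : b ≤ a₀ := by
    have := mul_le_mul_of_nonneg_left hbβ hs
    rw [ha₀]; linarith
  have ha₀pos : 0 < a₀ := hb.trans_le ha₀b
  have hσ0 : 0 ≤ σ := mul_nonneg hs ht
  have hτ0 : 0 ≤ τ := mul_nonneg (mul_nonneg ht hs') hb.le
  have hρ0 : 0 ≤ ρ := mul_nonneg ht' ha₀pos.le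
  have hcnn : 0 ≤ pfun σ τ ρ 1 1 := pfun_nonneg hσ0 hτ0 hρ0 zero_le_one zero_le_one
  have hone : pfun σ τ ρ (1 / b) (1 / a₀) = 1 := by
    simp only [pfun, hσ, hτ, hρ]; field_simp; ring
  -- the two classes of petals
  set P : Finset (Fin n) := univ.filter (fun j => y j ≤ x j) with hP
  set Q : Finset (Fin n) := univ.filter (fun j => ¬ (y j ≤ x j)) with hQ
  have hsplitF : ∏ j, pfun σ τ ρ (x j) (y j) = (∏ j ∈ P, pfun σ τ ρ (x j) (y j)) * ∏ j ∈ Q, pfun σ τ ρ (x j) (y j) :=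
    (prod_filter_mul_prod_filter_not univ _ _).symm
  have hsplitx : ∏ j, x j = (∏ j ∈ P, x j) * ∏ j ∈ Q, x j := (prod_filter_mul_prod_filter_not univ _ _).symm
  have hsplity : ∏ j, y j = (∏ j ∈ P, y j) * ∏ j ∈ Q, y j := (prod_filter_mul_prod_filter_not univ _ _).symm
  have hsplitz : ∏ j, z j = (∏ j ∈ P, z j) * ∏ j ∈ Q, z j := (prod_filter_mul_prod_filter_not univ _ _).symm
  have hcardPQ : P.card + Q.card = n := by
    rw [hP, hQ, Finset.card_filter_add_card_filter_not, card_univ, Fintype.card_fin]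
  have hXP1 : 1 ≤ ∏ j ∈ P, x j := one_le_prod_of_one_le P fun j _ => hx1 j
  have hYP1 : 1 ≤ ∏ j ∈ P, y j := one_le_prod_of_one_le P fun j _ => hy1 j
  have hZP1 : 1 ≤ ∏ j ∈ P, z j := one_le_prod_of_one_le P fun j _ => hz1 j
  have hXQ1 : 1 ≤ ∏ j ∈ Q, x j := one_le_prod_of_one_le Q fun j _ => hx1 j
  have hYQ1 : 1 ≤ ∏ j ∈ Q, y j := one_le_prod_of_one_le Q fun j _ => hy1 j
  have hZQ1 : 1 ≤ ∏ j ∈ Q, z j := one_le_prod_of_one_le Q fun j _ => hz1 j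
  have hQlt : ∀ j ∈ Q, x j < y j := fun j hj => not_le.1 (mem_filter.1 hj).2
  -- merged bounds for the two classes
  have hPm : P.Nonempty → ∏ j ∈ P, pfun σ τ ρ (x j) (y j) ≤
      pfun σ τ ρ 1 1 ^ (P.card - 1) * pfun σ τ ρ (∏ j ∈ P, x j) (∏ j ∈ P, y j) := fun hPn =>
    prod_pfun_le_merged hσ0 hτ0 hρ0 x y P hPn (fun j _ => hy1 j) (fun j hj => (mem_filter.1 hj).2)
  have hQm : Q.Nonempty → ∏ j ∈ Q, pfun σ τ ρ (x j) (y j) ≤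
      pfun σ τ ρ 1 1 ^ (Q.card - 1) * pfun σ τ ρ (∏ j ∈ Q, x j) (∏ j ∈ Q, y j) := fun hQn =>
    prod_pfun_le_merged' hσ0 hτ0 hρ0 x y Q hQn (fun j _ => hx1 j) (fun j hj => (hQlt j hj).le)
  rw [hsplitF]
  rcases Q.eq_empty_or_nonempty with hQe | hQn
  · -- no g-heavy petal
    have hQc0 : Q.card = 0 := by rw [hQe, card_empty]
    have hPn : P.Nonempty := by rw [← Finset.card_pos]; omega
    have hPc : P.card = n := by omega
    rw [hQe, prod_empty, mul_one]
    refine (hPm hPn).trans ?_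
    rw [hPc]
    rw [hQe, prod_empty, mul_one] at hsplitx hsplity
    have hXle : ∏ j ∈ P, x j ≤ 1 / b := by
      rw [le_div_iff₀ hb, mul_comm, ← hsplitx]; exact hPx
    have hYle : ∏ j ∈ P, y j ≤ 1 / a₀ := by
      rw [le_div_iff₀ ha₀pos, mul_comm, ← hsplity]; exact hPy
    calc pfun σ τ ρ 1 1 ^ (n - 1) * pfun σ τ ρ (∏ j ∈ P, x j) (∏ j ∈ P, y j)
        ≤ pfun σ τ ρ 1 1 ^ (n - 1) * pfun σ τ ρ (1 / b) (1 / a₀) :=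
          mul_le_mul_of_nonneg_left (pfun_mono hτ0 hρ0 hXle hYle) (pow_nonneg hcnn _)
      _ = pfun σ τ ρ 1 1 ^ (n - 1) := by rw [hone, mul_one]
  rcases P.eq_empty_or_nonempty with hPe | hPn
  · -- no u-heavy petal
    have hPc0 : P.card = 0 := by rw [hPe, card_empty]
    have hQc : Q.card = n := by omega
    rw [hPe, prod_empty, one_mul]
    refine (hQm hQn).trans ?_
    rw [hQc]
    rw [hPe, prod_empty, one_mul] at hsplitx hsplity
    have hXle : ∏ j ∈ Q, x j ≤ 1 / b := by
      rw [le_div_iff₀ hb, mul_comm, ← hsplitx]; exact hPx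
    have hYle : ∏ j ∈ Q, y j ≤ 1 / a₀ := by
      rw [le_div_iff₀ ha₀pos, mul_comm, ← hsplity]; exact hPy
    calc pfun σ τ ρ 1 1 ^ (n - 1) * pfun σ τ ρ (∏ j ∈ Q, x j) (∏ j ∈ Q, y j)
        ≤ pfun σ τ ρ 1 1 ^ (n - 1) * pfun σ τ ρ (1 / b) (1 / a₀) :=
          mul_le_mul_of_nonneg_left (pfun_mono hτ0 hρ0 hXle hYle) (pow_nonneg hcnn _)
      _ = pfun σ τ ρ 1 1 ^ (n - 1) := by rw [hone, mul_one]
  -- both classes nonempty: the budgets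
  set XP : ℝ := ∏ j ∈ P, x j with hXP
  set YP : ℝ := ∏ j ∈ P, y j with hYP
  set XQ : ℝ := ∏ j ∈ Q, x j with hXQ
  set YQ : ℝ := ∏ j ∈ Q, y j with hYQ
  set ZQ : ℝ := ∏ j ∈ Q, z j with hZQ
  have hZQpos : 0 < ZQ := zero_lt_one.trans_le hZQ1
  have hbX : b * (XP * XQ) ≤ 1 := by rw [← hsplitx]; exact hPx
  have haY : a₀ * (YP * YQ) ≤ 1 := by rw [← hsplity]; exact hPy
  have hβZ : β * ZQ ≤ 1 := by
    have h0 : ZQ ≤ (∏ j ∈ P, z j) * ZQ := le_mul_of_one_le_left hZQpos.le hZP1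
    have h1 : β * ZQ ≤ β * ((∏ j ∈ P, z j) * ZQ) := mul_le_mul_of_nonneg_left h0 hβpos.le
    rw [← hsplitz] at h1; exact h1.trans hPz
  -- the link for the merged g-heavy petal
  have hlinkQ : a₀ * YQ ≤ (1 - s) * b * XQ + s := by
    have h1 := prod_lfun_le hb.le hβpos.le hs hs1 x z Q hQn (fun j _ => hx1 j) (fun j hj => hxz j (hQlt j hj))
    rw [← ha₀, ← hXQ, ← hZQ] at h1
    have h2 : ∏ j ∈ Q, (a₀ * y j) ≤ ∏ j ∈ Q, lfun b β s (x j) (z j) :=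
      prod_le_prod (fun j _ => mul_nonneg ha₀pos.le (zero_le_one.trans (hy1 j))) fun j hj => hlink j (hQlt j hj)
    rw [prod_mul_distrib, prod_const, ← hYQ] at h2
    have hpow' : a₀ ^ Q.card = a₀ ^ (Q.card - 1) * a₀ := by
      rw [← pow_succ]; congr 1; have := hQn.card_pos; omega
    have h3 : a₀ ^ (Q.card - 1) * (a₀ * YQ) ≤ a₀ ^ (Q.card - 1) * lfun b β s XQ ZQ := by
      rw [← mul_assoc, ← hpow']; exact h2.trans h1
    have h4 : a₀ * YQ ≤ lfun b β s XQ ZQ := le_of_mul_le_mul_left h3 (pow_pos ha₀pos _)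
    have h5 : lfun b β s XQ ZQ ≤ (1 - s) * b * XQ + s := by
      have e1 : lfun b β s XQ ZQ = (1 - s) * b * XQ + s * (β * ZQ) := by simp only [lfun]; ring
      have e2 := mul_le_mul_of_nonneg_left hβZ hs
      rw [e1]; linarith
    exact h4.trans h5
  have hXYQ : XQ ≤ YQ := prod_le_prod (fun j _ => zero_le_one.trans (hx1 j)) fun j hj => (hQlt j hj).le
  -- assemble with the mixed step
  have hcard : (P.card - 1) + (Q.card - 1) + 1 = n - 1 := by
    have := hPn.card_pos; have := hQn.card_pos; omega
  have hAP0 : 0 ≤ ∏ j ∈ P, pfun σ τ ρ (x j) (y j) :=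
    prod_nonneg fun j _ => pfun_nonneg hσ0 hτ0 hρ0 (zero_le_one.trans (hx1 j)) (zero_le_one.trans (hy1 j))
  rw [← hcard]
  exact mixed_step hb hbβ hs hs1 ht ht1 hXP1 hYP1 hXQ1 hYQ1 hXYQ hbX haY hlinkQ hAP0 (hPm hPn) (hQm hQn)

/-- **THE PENDANT BOUND** (`b > 0`), see the module docstring. [this work] -/
theorem pendant_prod_le {n : ℕ} {b β s t : ℝ} (hb : 0 < b) (hbβ : b ≤ β) (hs : 0 ≤ s) (hs1 : s ≤ 1)
    (ht : 0 ≤ t) (ht1 : t ≤ 1) (u vv m : Fin n → ℝ) (hub : ∀ j, b ≤ u j) (hvβ : ∀ j, β ≤ vv j)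
    (hmb : ∀ j, b ≤ m j) (hmu : ∀ j, m j ≤ u j)
    (hpu : ∏ j, u j ≤ b ^ (n - 1)) (hpv : ∏ j, vv j ≤ β ^ (n - 1))
    (hpg : ∏ j, ((1 - s) * m j + s * vv j) ≤ ((1 - s) * b + s * β) ^ (n - 1)) :
    ∏ j, (s * t + s * (1 - t) * vv j + (1 - s) * t * u j + (1 - s) * (1 - t) * m j) ≤
      (s * t + s * (1 - t) * β + (1 - s) * b) ^ (n - 1) := by
  classical
  rcases Nat.eq_zero_or_pos n with hn | hn
  · subst hn; simp
  have hs' : 0 ≤ 1 - s := sub_nonneg.2 hs1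
  have ht' : 0 ≤ 1 - t := sub_nonneg.2 ht1
  have hβ : 0 < β := hb.trans_le hbβ
  set a₀ : ℝ := (1 - s) * b + s * β with ha₀
  have ha₀b : b ≤ a₀ := by
    have := mul_le_mul_of_nonneg_left hbβ hs
    rw [ha₀]; linarith
  have ha₀pos : 0 < a₀ := hb.trans_le ha₀b
  -- the normalised variables
  set g : Fin n → ℝ := fun j => (1 - s) * m j + s * vv j with hg
  set x : Fin n → ℝ := fun j => u j / b with hx
  set y : Fin n → ℝ := fun j => g j / a₀ with hy
  set z : Fin n → ℝ := fun j => vv j / β with hz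
  have hga : ∀ j, a₀ ≤ g j := fun j => by
    have e1 := mul_le_mul_of_nonneg_left (hmb j) hs'
    have e2 := mul_le_mul_of_nonneg_left (hvβ j) hs
    simp only [hg, ha₀]; linarith
  have hx1 : ∀ j, 1 ≤ x j := fun j => by simp only [hx]; rw [le_div_iff₀ hb, one_mul]; exact hub j
  have hy1 : ∀ j, 1 ≤ y j := fun j => by simp only [hy]; rw [le_div_iff₀ ha₀pos, one_mul]; exact hga j
  have hz1 : ∀ j, 1 ≤ z j := fun j => by simp only [hz]; rw [le_div_iff₀ hβ, one_mul]; exact hvβ j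
  -- the factors and the target in terms of `ψ`
  have hfac : ∀ j, s * t + s * (1 - t) * vv j + (1 - s) * t * u j + (1 - s) * (1 - t) * m j =
      pfun (s * t) (t * (1 - s) * b) ((1 - t) * a₀) (x j) (y j) := by
    intro j; simp only [pfun, hx, hy, hg]; field_simp; ring
  have hc : s * t + s * (1 - t) * β + (1 - s) * b = pfun (s * t) (t * (1 - s) * b) ((1 - t) * a₀) 1 1 := by
    simp only [pfun, ha₀]; ring
  -- budgets
  have hpow : ∀ (c : ℝ), c ^ n = c * c ^ (n - 1) := fun c => by
    conv_lhs => rw [show n = (n - 1) + 1 by omega, pow_succ]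
    ring
  have hPx : b * ∏ j, x j ≤ 1 := by
    simp only [hx]
    rw [prod_div_distrib, prod_const, card_univ, Fintype.card_fin, hpow b, mul_div_assoc', div_le_one (by positivity)]
    exact mul_le_mul_of_nonneg_left hpu hb.le
  have hPy : a₀ * ∏ j, y j ≤ 1 := by
    simp only [hy]
    rw [prod_div_distrib, prod_const, card_univ, Fintype.card_fin, hpow a₀, mul_div_assoc', div_le_one (by positivity)]
    exact mul_le_mul_of_nonneg_left hpg ha₀pos.le
  have hPz : β * ∏ j, z j ≤ 1 := by
    simp only [hz]
    rw [prod_div_distrib, prod_const, card_univ, Fintype.card_fin, hpow β, mul_div_assoc', div_le_one (by positivity)]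
    exact mul_le_mul_of_nonneg_left hpv hβ.le
  -- the link for g-heavy petals
  have hgb : ∀ j, g j * b ≤ (1 - s) * u j * b + s * vv j * b := fun j => by
    have e1 := mul_le_mul_of_nonneg_left (hmu j) hs'
    have e2 : g j ≤ (1 - s) * u j + s * vv j := by simp only [hg]; linarith
    have e3 := mul_le_mul_of_nonneg_right e2 hb.le
    linarith
  have hxz : ∀ j, x j < y j → x j ≤ z j := by
    intro j hlt
    simp only [hx, hy, hz] at hlt ⊢
    rw [div_lt_div_iff₀ hb ha₀pos] at hlt
    rw [div_le_div_iff₀ hb hβ]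
    have h2 : u j * a₀ = (1 - s) * u j * b + s * (u j * β) := by rw [ha₀]; ring
    have h3 : s * (u j * β) < s * (vv j * b) := by linarith [hgb j]
    exact (lt_of_mul_lt_mul_left h3 hs).le
  have hlink : ∀ j, x j < y j → a₀ * y j ≤ lfun b β s (x j) (z j) := by
    intro j _
    have e0 : a₀ * y j = g j := by simp only [hy]; rw [mul_div_cancel₀ _ ha₀pos.ne']
    have e1 : lfun b β s (x j) (z j) = (1 - s) * u j + s * vv j := by
      simp only [lfun, hx, hz]; field_simp
    have e2 := mul_le_mul_of_nonneg_left (hmu j) hs'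
    rw [e0, e1]; simp only [hg]; linarith
  rw [prod_congr rfl fun j _ => hfac j, hc]
  exact normalised_bound hb hbβ hs hs1 ht ht1 x y z hx1 hy1 hz1 hPx hPy hPz hxz hlink

end Pendant

end SafeCalc

end Summit.CriticalPhenomena.PercolationContinuityZ3.Theorems.SunflowerPartition
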